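import Mathlib.FieldTheory.Finite.GaloisField
import Literature.AnabelianGeometry.EtaleTheta.LogDivisorModelConstantFieldGalois
import Literature.AnabelianGeometry.EtaleTheta.Discharge.Sec3Prop34CnstTorsionOfGaloisCovering

/-!
# [EtTh] Thm. 3.7 (iii), `Λ = ℚ` clause: the TORSION Galois-correspondence binder is NOT a consequence of a
# constant-field structure — kernel countermodel at a finite constant field

S. Mochizuki, *The étale theta function …*, Publ. RIMS **45** (2009) [MochizukiEtTh2009], §3, Thm. 3.7 (iii), PRIMS
PDF p.79 l.−6 – p.80 l.2: "the natural action of `Aut_C(A)` on `O^▷(A)` and `O^×(A)` factors through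
`Aut_{D^cnst}(A^cnst)`.  If, moreover, `Λ ∈ {ℤ, ℚ}`, then this factorization determines a faithful action"
[cite: MochizukiEtTh2009, Thm 3.7 (iii) p.79].

PROOF-ONLY (abc-iut cell, W6 seat d058 lineage, gen 3; 0 defs; abc-iut-L2-t3's binder and this seat's structure
consumed BY NAME).  Two binders on a Galois action `A` over the Def. 3.1 interface encode the `Λ = ℤ` and `Λ = ℚ`
readings of that sentence: `GaloisAction.ConstGaloisLaw A` (exact fixing of `H`-invariant unit integral constants;
GAP G-w6d058-2) and abc-iut-L2-t3's `GaloisAction.ConstGaloisLawTorsion A` (fixing UP TO TORSION,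
`(a·u)^N = u^N`; p447930), the latter implying the former.  `LogDivisorModelConstantFieldGalois.lean` proves the
`Λ = ℤ` law from ANY constant-field structure `GaloisAction.ConstField` (finite extension `L/K`, valuation,
`res : G ↠ Aut(L/K)`, `L^× = const`, `O_L^▷ = intConst`).  THIS FILE shows the `Λ = ℚ` law is NOT so derivable:

* `constOnlyAction_actFn_pow_card` — on the constants-only model of a field with FINITE unit group every unit is
  torsion, so the torsion hypothesis `(a·u)^N = u^N` holds for EVERY `a` (`N := |L^×|`);
* **`constGaloisLawTorsion_constOnlyAction_iff`** — hence there the torsion law holds iff `Aut(L/K)` is trivial;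
* **`not_constGaloisLawTorsion_galoisField`** — at `𝔽_4/𝔽_2` (`GaloisField 2 2` over `ZMod 2`, Frobenius `≠ 1`)
  the torsion law FAILS, although (`LogDivisorModelConstantFieldGalois`) this datum carries a `ConstField`
  structure and satisfies `ConstGaloisLaw`: `constField_and_constGaloisLaw_and_not_torsion_galoisField`.
READING (for the binder's owner and the census): the torsion form records RANK information about `O_L^×` that is
true in print's setting (`L/ℚ_p` finite: for `W ⊊ L` the quotient `O_L^×/O_W^×` is never torsion, by the structure
`O_L^× ≅ μ × ℤ_p^{[L:ℚ_p]}`), but is invisible to «finite extension + valuation + Galois correspondence + units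
generate»; a side condition such as «for every `N ≥ 1` the `N`-th powers of the units of each intermediate
valuation ring generate that field» would make it derivable.  Nothing here says the torsion binder is false for
`p`-adic constant fields.  HONEST FRAMING: a statement about OUR typed binders and a degenerate model; nothing here
bears on [IUTchIII] Cor. 3.12; no side taken; typed ≠ proved.
-/

namespace Literature.AnabelianGeometry.EtaleTheta

namespace LogDivisorModel

open GaloisAction

universe u

variable (K L : Type u) [Field K] [Field L] [Algebra K L] [Finite Lˣ]

/-- On the constants-only model every unit is torsion: `(a·u)^N = u^N = 1` with `N := |L^×|`, for EVERY `a`.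
[cite: MochizukiEtTh2009, Thm 3.7 (iii) p.79] -/
theorem constOnlyAction_actFn_pow_card (a : L ≃ₐ[K] L) (u : (constOnly L).Fn) :
    ((constOnlyAction K L).actFn a u) ^ Nat.card Lˣ = u ^ Nat.card Lˣ := by
  have h1 : ∀ x : Lˣ, x ^ Nat.card Lˣ = 1 := fun x => pow_card_eq_one'
  exact (h1 ((constOnlyAction K L).actFn a u)).trans (h1 u).symm

/-- **On the constants-only model the torsion law holds iff `Aut(L/K)` is trivial** (the torsion hypothesis is
vacuous there and `N = 1`). [cite: MochizukiEtTh2009, Thm 3.7 (iii) p.79] -/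
theorem constGaloisLawTorsion_constOnlyAction_iff [FiniteDimensional K L] :
    (constOnlyAction K L).ConstGaloisLawTorsion ↔ ∀ a : L ≃ₐ[K] L, a = 1 := by
  constructor
  · intro h a
    obtain ⟨n, hn, hna⟩ := h.exists_mem_constInertia ⊥ a fun u _ _ _ =>
      ⟨⟨Nat.card Lˣ, Nat.card_pos⟩, constOnlyAction_actFn_pow_card K L a u⟩
    rw [constInertia_constOnlyAction, Subgroup.mem_bot] at hn
    rw [Subgroup.mem_bot, hn, inv_one, one_mul] at hna
    exact hna
  · intro h
    exact ⟨fun H a _ => ⟨1, (constOnlyAction K L).constInertia.one_mem, by rw [h a, inv_one, mul_one]; exact H.one_mem⟩⟩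

/-- Hence the torsion law FAILS on the constants-only model as soon as `Aut(L/K)` has a non-trivial element.
[cite: MochizukiEtTh2009, Thm 3.7 (iii) p.79] -/
theorem not_constGaloisLawTorsion_constOnlyAction [FiniteDimensional K L] (a : L ≃ₐ[K] L) (ha : a ≠ 1) :
    ¬ (constOnlyAction K L).ConstGaloisLawTorsion := fun h =>
  ha ((constGaloisLawTorsion_constOnlyAction_iff K L).1 h a)

/-- `𝔽_4/𝔽_2` has a non-trivial automorphism (its Galois group has order `2`). [folklore] -/
private theorem exists_algEquiv_ne_one_galoisField : ∃ a : GaloisField 2 2 ≃ₐ[ZMod 2] GaloisField 2 2, a ≠ 1 := by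
  by_contra h
  have h' : ∀ a : GaloisField 2 2 ≃ₐ[ZMod 2] GaloisField 2 2, a = 1 := fun a => not_ne_iff.1 (not_exists.1 h a)
  haveI : Subsingleton (GaloisField 2 2 ≃ₐ[ZMod 2] GaloisField 2 2) := ⟨fun a b => by rw [h' a, h' b]⟩
  have hcard : Nat.card (GaloisField 2 2 ≃ₐ[ZMod 2] GaloisField 2 2) = 2 := by
    rw [IsGalois.card_aut_eq_finrank, GaloisField.finrank 2 two_ne_zero]
  have h1 : Nat.card (GaloisField 2 2 ≃ₐ[ZMod 2] GaloisField 2 2) = 1 := Nat.card_of_subsingleton 1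
  omega

/-- **Kernel countermodel: the torsion binder fails at the finite constant field `𝔽_4/𝔽_2`** (constants-only
model, `Aut = ⟨Frobenius⟩ ≅ ℤ/2`). [cite: MochizukiEtTh2009, Thm 3.7 (iii) p.79] -/
theorem not_constGaloisLawTorsion_galoisField :
    ¬ (constOnlyAction (ZMod 2) (GaloisField 2 2)).ConstGaloisLawTorsion := by
  obtain ⟨a, ha⟩ := exists_algEquiv_ne_one_galoisField
  exact not_constGaloisLawTorsion_constOnlyAction (ZMod 2) (GaloisField 2 2) a ha

/-- **The torsion law is NOT a consequence of a constant-field structure**: at `𝔽_4/𝔽_2` the datum carries a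
`ConstField` structure and satisfies the `Λ = ℤ` law `ConstGaloisLaw`, yet violates `ConstGaloisLawTorsion`.
[cite: MochizukiEtTh2009, Thm 3.7 (iii) p.79] -/
theorem constField_and_constGaloisLaw_and_not_torsion_galoisField :
    Nonempty ((constOnlyAction (ZMod 2) (GaloisField 2 2)).ConstField (ZMod 2) (GaloisField 2 2)
        (WithZero (Multiplicative ℤ))) ∧
      (constOnlyAction (ZMod 2) (GaloisField 2 2)).ConstGaloisLaw ∧
      ¬ (constOnlyAction (ZMod 2) (GaloisField 2 2)).ConstGaloisLawTorsion := by
  classical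
  exact ⟨nonempty_constField _ _ _, constGaloisLaw_constOnlyAction _ _, not_constGaloisLawTorsion_galoisField⟩

/-- In implication form: «every Galois action with a constant field satisfies the torsion law» is FALSE.
[cite: MochizukiEtTh2009, Thm 3.7 (iii) p.79] -/
theorem not_forall_constField_constGaloisLawTorsion :
    ¬ ∀ (Z : LogDivisorModel.{0}) (G : Type) [Group G] (A : Z.GaloisAction G) (K L : Type) [Field K] [Field L]
        [Algebra K L], Nonempty (A.ConstField K L (WithZero (Multiplicative ℤ))) → A.ConstGaloisLawTorsion := by
  intro h
  classical
  exact not_constGaloisLawTorsion_galoisField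
    (h _ _ (constOnlyAction (ZMod 2) (GaloisField 2 2)) (ZMod 2) (GaloisField 2 2) (nonempty_constField _ _ _))

end LogDivisorModel

end Literature.AnabelianGeometry.EtaleTheta
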